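import Mathlib.Analysis.InnerProductSpace.Calculus
import Literature.Geometry.Lorentzian.LeviCivitaCurvature
import HarnessLib

/-!
# The tangential connection of an isometric immersion into a Euclidean space
(topic `Geometry/Lorentzian`, companion of `LeviCivita.lean` / `LeviCivitaProofs.lean`)

For a manifold `M` with a pseudo-Riemannian metric `g` realised by a map `ι : M → V` into a real
inner product space (`g_y(v, w) = ⟪dι_y v, dι_y w⟫`, an isometric immersion into `(V, ⟪·,·⟫)`),
the Levi-Civita connection is the tangential part of the ambient derivative: Lee 2018,
Example 4.9 (the tangential connection `∇^⊤_X Y = π^⊤(∇̄_X Ỹ)`) and Prop. 5.12 (b) ("the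
Levi-Civita connection on `M` is equal to the tangential connection"). This file proves the
form of that statement consumed by curvature computations of concrete hypersurfaces (the round
sphere, `Literature/Geometry/Riemannian/RoundSphereProofs.lean`):

* `hasMFDerivAt_inner`, `mvfderiv_inner_apply`, `mvfderiv_inner_const_left` — the product rule
  for `y ↦ ⟪f y, f₂ y⟫` along a manifold (Mathlib has the normed-space case
  `HasFDerivWithinAt.inner`), with Mathlib's `mvfderiv`;
* `mvfderiv_apply_mlieBracket_vec` — **the bracket as a commutator on `V`-valued functions**,
  `df_x([X, Y]_x) = X_x(Y f) - Y_x(X f)` for `f : M → V` (from the scalar case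
  `Literature.Geometry.Lorentzian.mvfderiv_apply_mlieBracket` of `CurvatureSymmetries.lean`,
  Gallot–Hulin–Lafontaine 2004, Def. 1.52 bis); with `f = ι` this is the naturality
  `dι [X, Y] = D_X (ι_* Y) - D_Y (ι_* X)` of the bracket under the immersion;
* `IsLeviCivita.inner_mvfderiv_cov_apply` — **the tangential Gauss formula**: for ANY
  torsion-free `g`-compatible covariant derivative `cov` (the tree phrases metric notions over
  arbitrary such `cov`, see `LeviCivitaCurvature.lean`) and `Y` of class `C²` at `x`,
  `⟪dι(∇_{X₀} Y), dι W₀⟫ = ⟪d(ι_* Y)_x X₀, dι W₀⟫`, i.e. `dι(∇_{X₀} Y)` is the orthogonal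
  projection of `D_{X₀}(ι_* Y)` onto `dι(T_x M)`. The proof is the Koszul formula for `cov`
  (`IsLeviCivita.two_mul_val_apply_eq_koszulFunctional`, O'Neill 1983, Thm. 3.11) with the three
  derivative terms expanded by the product rule and the three brackets pushed to `V`;
* `exists_isOpen_contMDiffOn_extend_infty` — smooth local extensions of tangent vectors on a
  `C^∞` manifold (bookkeeping).

Not here: the normal part (second fundamental form; `Hypersurface.lean` has the definitions), the
Gauss equation in general — only its sphere instance is carried out, in `RoundSphereProofs.lean`.

## References

* [Lee2018] J. M. Lee, *Introduction to Riemannian Manifolds*, 2nd ed., GTM 176, Springer 2018,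
  Example 4.9 (the tangential connection), Props. 5.8, 5.9 and 5.12 (b).
* [ONeill1983] B. O'Neill, *Semi-Riemannian geometry*, Academic Press 1983, Ch. 3, Thm. 3.11.
* [GallotHulinLafontaine2004] S. Gallot, D. Hulin, J. Lafontaine, *Riemannian Geometry*, 3rd ed.,
  Springer 2004, Def. 1.52 bis.
-/

noncomputable section

open Bundle Set NormedSpace FiberBundle VectorField
open scoped Manifold ContDiff Topology RealInnerProductSpace

namespace Literature.Geometry.Lorentzian

variable {E : Type*} [NormedAddCommGroup E] [NormedSpace ℝ E] {H : Type*} [TopologicalSpace H]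
  {I : ModelWithCorners ℝ E H} {M : Type*} [TopologicalSpace M] [ChartedSpace H M]
  {V : Type*} [NormedAddCommGroup V] [InnerProductSpace ℝ V] {x : M}

/-! ## Calculus of maps into a Euclidean space along a manifold -/

/-- Product rule for the inner product of two `V`-valued functions on a manifold (`HasMFDerivAt`
form): `d⟪f, f₂⟫ = ⟪f, df₂ ·⟫ + ⟪df ·, f₂⟫`, packaged as `fderivInnerCLM ℝ (f x, f₂ x) ∘ (f', f₂')`.
Mathlib has the normed-space version `HasFDerivWithinAt.inner`; transported through the chart at
`x` exactly as Mathlib's `HasMFDerivWithinAt.mul'`. [folklore] -/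
theorem hasMFDerivAt_inner {f f₂ : M → V} {f' f₂' : TangentSpace I x →L[ℝ] V}
    (hf : HasMFDerivAt I 𝓘(ℝ, V) f x f') (hf₂ : HasMFDerivAt I 𝓘(ℝ, V) f₂ x f₂') :
    HasMFDerivAt I 𝓘(ℝ, ℝ) (fun y ↦ ⟪f y, f₂ y⟫) x
      ((fderivInnerCLM ℝ (f x, f₂ x)).comp (f'.prod f₂')) :=
  ⟨hf.1.inner hf₂.1, by simpa only [mfld_simps] using! hf.2.inner ℝ hf₂.2⟩

/-- The inner product of two differentiable `V`-valued functions on a manifold is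
differentiable. [folklore] -/
theorem mdifferentiableAt_inner {f f₂ : M → V} (hf : MDifferentiableAt I 𝓘(ℝ, V) f x)
    (hf₂ : MDifferentiableAt I 𝓘(ℝ, V) f₂ x) :
    MDifferentiableAt I 𝓘(ℝ, ℝ) (fun y ↦ ⟪f y, f₂ y⟫) x :=
  (hasMFDerivAt_inner hf.hasMFDerivAt hf₂.hasMFDerivAt).mdifferentiableAt

/-- Product rule `d⟪f, f₂⟫_x(v) = ⟪f x, df₂ v⟫ + ⟪df v, f₂ x⟫` for `V`-valued functions on a
manifold, with Mathlib's `mvfderiv`. [folklore] -/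
theorem mvfderiv_inner_apply {f f₂ : M → V} (hf : MDifferentiableAt I 𝓘(ℝ, V) f x)
    (hf₂ : MDifferentiableAt I 𝓘(ℝ, V) f₂ x) (v : TangentSpace I x) :
    mvfderiv I (fun y ↦ ⟪f y, f₂ y⟫) x v =
      ⟪f x, mvfderiv I f₂ x v⟫ + ⟪mvfderiv I f x v, f₂ x⟫ := by
  have h := (hasMFDerivAt_inner hf.hasMFDerivAt hf₂.hasMFDerivAt).mfderiv
  simp only [mvfderiv, ContinuousLinearMap.coe_comp, ContinuousLinearEquiv.coe_coe,
    Function.comp_apply, h]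
  rfl

omit [InnerProductSpace ℝ V] in
/-- Congruence of `mvfderiv` under eventual equality, for functions into any normed space
(Mathlib has `Filter.EventuallyEq.mfderiv_eq`; `CurvatureSymmetries.lean` has the scalar case
`mvfderiv_congr_of_eventuallyEq`). [folklore] -/
theorem mvfderiv_congr_nhds [NormedSpace ℝ V] {f f' : M → V} (h : f =ᶠ[𝓝 x] f') :
    mvfderiv I f x = mvfderiv I f' x := by
  have h1 : mfderiv I 𝓘(ℝ, V) f x = mfderiv I 𝓘(ℝ, V) f' x := h.mfderiv_eq
  have h2 : f x = f' x := h.eq_of_nhds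
  unfold mvfderiv
  rw [h1, h2]

/-- `d⟪a, f⟫_x(v) = ⟪a, df v⟫` for a constant vector `a`. [folklore] -/
theorem mvfderiv_inner_const_left (a : V) {f : M → V} (hf : MDifferentiableAt I 𝓘(ℝ, V) f x)
    (v : TangentSpace I x) :
    mvfderiv I (fun y ↦ ⟪a, f y⟫) x v = ⟪a, mvfderiv I f x v⟫ := by
  rw [mvfderiv_inner_apply mdifferentiableAt_const hf, mvfderiv_const]
  simp

/-- **The Lie bracket is the commutator of the derivations, for vector-valued functions.** On a
real `C^∞` manifold with complete model space, for `f : M → V` of class `C²` at `x` and vector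
fields `X`, `Y` of class `C²` at `x`: `df_x([X, Y]_x) = X_x(Y f) - Y_x(X f)` in `V`, i.e.
`d f x (mlieBracket I X Y x) = d (y ↦ d f y (Y y)) x (X x) - d (y ↦ d f y (X y)) x (Y x)`.
Gallot–Hulin–Lafontaine 2004, Def. 1.52 bis (the scalar identity; Mathlib has the normed-space
case `VectorField.fderiv_apply_lieBracket`); obtained from the scalar case
`Literature.Geometry.Lorentzian.mvfderiv_apply_mlieBracket` applied to `⟪a, f⟫` for every
`a : V`. For `f` an immersion `ι` this is the naturality of the bracket,
`dι[X, Y] = D_X(ι_* Y) - D_Y(ι_* X)`. [cite: GallotHulinLafontaine2004, Def. 1.52 bis] -/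
theorem mvfderiv_apply_mlieBracket_vec [IsManifold I ∞ M] [CompleteSpace E] {f : M → V}
    {X Y : Π x : M, TangentSpace I x} (hf : ContMDiffAt I 𝓘(ℝ, V) 2 f x)
    (hX : CMDiffAt 2 (T% X) x) (hY : CMDiffAt 2 (T% Y) x) :
    mvfderiv I f x (mlieBracket I X Y x) =
      mvfderiv I (fun y ↦ mvfderiv I f y (Y y)) x (X x)
        - mvfderiv I (fun y ↦ mvfderiv I f y (X y)) x (Y x) := by
  refine ext_inner_left ℝ fun a ↦ ?_
  have hfa : ContMDiffAt I 𝓘(ℝ, ℝ) 2 (fun y ↦ ⟪a, f y⟫) x :=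
    (contDiff_const.inner ℝ contDiff_id).comp_contMDiffAt hf
  have key := mvfderiv_apply_mlieBracket (I := I) hfa hX hY
  -- `f` is differentiable near `x` and at `x`
  have hfn : ∀ᶠ y in 𝓝 x, MDifferentiableAt I 𝓘(ℝ, V) f y :=
    ((contMDiffAt_iff_contMDiffAt_nhds (by simp)).1 hf).mono
      fun y hy ↦ hy.mdifferentiableAt two_ne_zero
  have hfx : MDifferentiableAt I 𝓘(ℝ, V) f x := hf.mdifferentiableAt two_ne_zero
  -- the first derivatives along a field `A`, near `x`
  have h1 : ∀ A : Π x : M, TangentSpace I x,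
      (fun y ↦ mvfderiv I (fun y ↦ ⟪a, f y⟫) y (A y)) =ᶠ[𝓝 x]
        fun y ↦ ⟪a, mvfderiv I f y (A y)⟫ := fun A ↦
    hfn.mono fun y hy ↦ mvfderiv_inner_const_left a hy (A y)
  have hG : ∀ {A : Π x : M, TangentSpace I x}, CMDiffAt 2 (T% A) x →
      MDifferentiableAt I 𝓘(ℝ, V) (fun y ↦ mvfderiv I f y (A y)) x := fun hA ↦
    (VectorField.contMDiffAt_mvfderiv_apply_of_contMDiffAt hf (hA.of_le one_le_two)
      (by norm_num)).mdifferentiableAt one_ne_zero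
  rw [mvfderiv_inner_const_left a hfx, mvfderiv_congr_nhds (h1 Y), mvfderiv_congr_nhds (h1 X),
    mvfderiv_inner_const_left a (hG hY), mvfderiv_inner_const_left a (hG hX)] at key
  rw [key, inner_sub_right]

/-- On a `C^∞` manifold the canonical extension `FiberBundle.extend E X₀` of a tangent vector is
`C^∞` on an open neighbourhood of its base point (Mathlib's `FiberBundle.exists_contMDiffOn_extend`
in the `C^∞` tangent bundle; `CurvatureProofs.lean` has the `C²` version). [folklore] -/
theorem exists_isOpen_contMDiffOn_extend_infty [IsManifold I ∞ M] (X₀ : TangentSpace I x) :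
    ∃ u : Set M, IsOpen u ∧ x ∈ u ∧ CMDiff[u] ∞ (T% (extend E X₀)) := by
  have : IsManifold I (∞ + 1) M := inferInstanceAs (IsManifold I ∞ M)
  have : ContMDiffVectorBundle ∞ E (TangentSpace I : M → Type _) I :=
    TangentBundle.contMDiffVectorBundle
  obtain ⟨s, hs, h⟩ := exists_contMDiffOn_extend (k := ∞) I E X₀
  exact ⟨interior s, isOpen_interior, mem_interior_iff_mem_nhds.2 hs, h.mono interior_subset⟩

/-! ## The tangential Gauss formula -/

section Tangential

variable [IsManifold I ∞ M] [FiniteDimensional ℝ E] [CompleteSpace E] {n : ℕ∞ω}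
  {g : PseudoRiemannianMetric I n E (TangentSpace I : M → Type _)}
  {cov : CovariantDerivative I E (TangentSpace I : M → Type _)} {ι : M → V}

namespace PseudoRiemannianMetric

/-- **Gauss formula, tangential part: the Levi-Civita connection of an isometrically immersed
manifold is the tangential projection of the ambient derivative.** Let `ι : M → V` be a `C²` map
into a real inner product space with `g_y(v, w) = ⟪dι_y v, dι_y w⟫` for all tangent vectors, and
let `cov` be torsion-free and compatible with `g`. For a vector field `Y` of class `C²` at `x`
and `X₀, W₀ ∈ T_x M`: `⟪dι(∇_{X₀} Y), dι W₀⟫ = ⟪d(ι_* Y)_x X₀, dι W₀⟫`, where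
`ι_* Y : y ↦ dι_y (Y y)` is `Y` as a `V`-valued function; that is, the component of the ambient
derivative `D_{X₀}(ι_* Y)` along `dι(T_x M)` is `dι(∇_{X₀} Y)`. Lee 2018, Prop. 5.12 (b) with
Example 4.9 (`∇^⊤_X Y = π^⊤(∇̄_X Ỹ)` is the Levi-Civita connection of an embedded submanifold of
`ℝⁿ`; Props. 5.8–5.9). The proof here runs through the Koszul formula for `cov` (O'Neill 1983,
Thm. 3.11, `IsLeviCivita.two_mul_val_apply_eq_koszulFunctional`): on extensions `X`, `W` of
`X₀`, `W₀`, the three derivative terms are product rules in `V` and the three bracket terms are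
`⟪ι_* A, D_B(ι_* C) - D_C(ι_* B)⟫` (`mvfderiv_apply_mlieBracket_vec`); everything cancels but
`2⟪D_{X₀}(ι_* Y), ι_* W⟫`. [cite: Lee2018, Prop. 5.12 (b) and Example 4.9] -/
theorem IsLeviCivita.inner_mvfderiv_cov_apply (h : g.IsLeviCivita cov)
    (hι : ContMDiff I 𝓘(ℝ, V) 2 ι)
    (hg : ∀ (y : M) (v w : TangentSpace I y),
      g.val y v w = ⟪mvfderiv I ι y v, mvfderiv I ι y w⟫)
    {Y : Π x : M, TangentSpace I x} (hY : CMDiffAt 2 (T% Y) x) (X₀ W₀ : TangentSpace I x) :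
    ⟪mvfderiv I ι x (cov Y x X₀), mvfderiv I ι x W₀⟫ =
      ⟪mvfderiv I (fun y ↦ mvfderiv I ι y (Y y)) x X₀, mvfderiv I ι x W₀⟫ := by
  -- extensions of `X₀`, `W₀` of class `C²` at `x`
  set X : Π x : M, TangentSpace I x := extend E X₀ with hXdef
  set W : Π x : M, TangentSpace I x := extend E W₀ with hWdef
  have hX : CMDiffAt 2 (T% X) x := contMDiffAt_extend (I := I) (F := E) X₀
  have hW : CMDiffAt 2 (T% W) x := contMDiffAt_extend (I := I) (F := E) W₀
  have hXx : X x = X₀ := extend_apply_self E X₀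
  have hWx : W x = W₀ := extend_apply_self E W₀
  -- the Koszul formula for `cov`
  have hK := h.two_mul_val_apply_eq_koszulFunctional (hX.mdifferentiableAt two_ne_zero)
    (hY.mdifferentiableAt two_ne_zero) (hW.mdifferentiableAt two_ne_zero)
  -- the lifted fields `ι_* A` are differentiable at `x`
  have hL : ∀ {A : Π x : M, TangentSpace I x}, CMDiffAt 2 (T% A) x →
      MDifferentiableAt I 𝓘(ℝ, V) (fun y ↦ mvfderiv I ι y (A y)) x := fun hA ↦
    (VectorField.contMDiffAt_mvfderiv_apply_of_contMDiffAt (hι x) (hA.of_le one_le_two)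
      (by norm_num)).mdifferentiableAt one_ne_zero
  -- the brackets, pushed to `V`
  have hbr : ∀ {A B : Π x : M, TangentSpace I x}, CMDiffAt 2 (T% A) x → CMDiffAt 2 (T% B) x →
      mvfderiv I ι x (mlieBracket I A B x) =
        mvfderiv I (fun y ↦ mvfderiv I ι y (B y)) x (A x)
          - mvfderiv I (fun y ↦ mvfderiv I ι y (A y)) x (B x) :=
    fun hA hB ↦ mvfderiv_apply_mlieBracket_vec (hι x) hA hB
  simp only [koszulFunctional, hg, hbr hY hW, hbr hW hX, hbr hX hY,
    mvfderiv_inner_apply (hL hY) (hL hW), mvfderiv_inner_apply (hL hW) (hL hX),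
    mvfderiv_inner_apply (hL hX) (hL hY), inner_sub_right, hXx, hWx] at hK
  have c1 := real_inner_comm (mvfderiv I ι x X₀)
    (mvfderiv I (fun y ↦ mvfderiv I ι y (W y)) x (Y x))
  have c2 := real_inner_comm (mvfderiv I ι x (Y x))
    (mvfderiv I (fun y ↦ mvfderiv I ι y (X y)) x W₀)
  have c3 := real_inner_comm (mvfderiv I ι x W₀)
    (mvfderiv I (fun y ↦ mvfderiv I ι y (Y y)) x X₀)
  linarith

end PseudoRiemannianMetric

end Tangential

end Literature.Geometry.Lorentzian

end
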